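import Literature.NumberTheory.GaloisCohomology.Howard2004.SelmerAIndexLevelwiseProofs
import Literature.NumberTheory.EllipticCurves.IwasawaSelmerReadoutKernelQuotientProofs
import Literature.NumberTheory.EllipticCurves.ZpExtensionEisensteinTowerReadoutBijectiveProofs
import Literature.NumberTheory.EllipticCurves.ZpExtensionEisensteinDVRSetting
import HarnessLib

/-!
# `#(Sel_∞[ψ_m] ⧸ readout(H¹_F(K, A_𝔮)))` from LOCAL indices at finitely many places
# (Howard Prop. 2.2.8, second map, at `𝔮 = T^m + p`: the bookkeeping down to place-wise arithmetic) — proofs file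

Topic `NumberTheory/EllipticCurves` (sequel to `IwasawaSelmerReadoutKernelQuotientProofs`, p671042, and
`GaloisCohomology/Howard2004/SelmerAIndexLevelwiseProofs`, p672668). THEOREMS ONLY: no definition, no named fact, no
instance, no `sorry`.

WHY (cell `pub/bsd-print-x9`, shared μ-crux `MuInequalityCoherentPairOfPrintCG` stmt-BirchSwinnertonDyer-23428, STUB B; the
registered clause `HeegnerMuPartControlGlue.Stmt.readoutIndex` (B5, p670216) asks, for `m ≫ 0` and every admissible Eisenstein
datum, `Finite Q ∧ #Q ≤ p^c` for `Q := Sel_∞[ψ_m] ⧸ (readout(H¹_F(K, A_𝔮)) ∩ Sel_∞)`; seat `bsd-line-x10b-p1-w2` g11, brick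
(B5-GLOB)). This file is the E-side WRAPPER: it turns the two conjuncts into PLACE-WISE inputs at ONE tower level at a time.

* §1 (any `DVRSetting` `St` over any DVR, any curve `V/K`, any additive readout `ι₀ : H¹(K, A) → H¹(K_∞, E[p^∞])`)
  **`finite_and_natCard_kerPsi_quotient_le_of_local`** — given (B1) `ι₀` injective, `ψ_m ∘ ι₀ = 0`, (B2) `ι₀` onto the
  `ψ_m`-torsion, a finite set `S` of finite places, relaxed local conditions `F'_{j,v}` (`v ∈ S`, `j ≥ j₀`) such that every
  class `c ∈ H¹(K, T_j)` whose readout is Selmer over `K_∞` has `loc_v c ∈ F'_{j,v}` (`v ∈ S`) and `loc_v c ∈ condA F j v` at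
  the other finite places and at the infinite places, and `∏_{v ∈ S} #(F'_{j,v} ⧸ condA F j v ∩ F'_{j,v}) ≤ C` (finite):
  then `Q` is finite and `#Q ≤ C` (= p671042 `natCard_quotient_eq_of_readout` ∘ p672668
  `DVRSetting.finite_and_natCard_quotient_selmerA_le_prod_finite`).
* §2 (the curve `E = W_K`, Howard's Eisenstein setting `St := W.eisensteinDVRSetting (κ.unitTwist (-1)) hm …`, readout
  `ι₀ := W.eisensteinTowerReadout`) **`finite_and_natCard_kerPsi_quotient_eisensteinTowerReadout_le_of_local`** — the same
  with (B1)/(B2)/`ψ_m ∘ ι₀ = 0` DISCHARGED from `E(K)[p] = 0` and a topological generator `γ` (p665989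
  `eisensteinTowerReadout_injective` / `exists_eisensteinTowerReadout_eq`, p662975 `psi_apply_eisensteinTowerReadout_eq_zero`),
  binders and conclusion in the letter of `Stmt.readoutIndex` (so that clause = `∃ c m₁ ∀ m ∀ datum` + the place-wise inputs).

HONEST FRAMING: the place-wise inputs (the relaxed conditions at `v ∈ S` with their `m`-UNIFORM local indices — at `v ∣ p`
after Coates–Greenberg / Greenberg LNM 1716 Prop. 2.4 — and the «no contribution» statement at the good places) are
NOT proved here; they are the arithmetic content of (B5). BSD is not proved by any of this.

References: [Howard2004HeegnerKolyvagin] Prop. 2.2.8 (second map) and proof of Thm. 2.2.10 (arXiv:1202.6340 p. 17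
L41–53, p. 18 L31); [GreenbergLNM1716] §4 pp. 98, 104, 124.
-/

set_option autoImplicit false

noncomputable section

open Function NumberField IsDedekindDomain Field
open scoped Classical NumberField ContRepresentation TensorProduct

namespace WeierstrassCurve

open Literature Literature.NumberTheory.EllipticCurves
open Literature.NumberTheory.GaloisCohomology Literature.NumberTheory.GaloisCohomology.Howard2004
open Literature.NumberTheory.GaloisRepresentations Literature.NumberTheory.GaloisRepresentations.DiscreteGaloisModule

/-! ## §1 Generic: any `DVRSetting`, any readout with (B1)/(B2)/`ψ_m ∘ ι₀ = 0` -/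

/-- **`Sel_∞[ψ_m] ⧸ (ι₀(H¹_F(K, A)) ∩ Sel_∞)` is finite of order `≤ C` from place-wise inputs at one level at a time.**
`St` a `DVRSetting` with H.0–H.5 over a DVR, `V/K` a curve, `ι₀ : H¹(K, A) → H¹(K_∞, E[p^∞])` additive, injective (B1),
killed by `ψ_m = (θ − 1)^m + p` and onto its kernel (B2); `S` a finite set of finite places; for `j ≥ j₀` relaxed conditions
`F'_{j,v}` at `v ∈ S` containing `loc_v c` for every `c ∈ H¹(K, T_j)` whose class reads out into `Sel_∞`, such classes having
`loc c ∈ condA F j` at all other places, and `∏_{v ∈ S} #(F'_{j,v} ⧸ condA ∩ F'_{j,v}) ≤ C` with finite factors.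
[cite: Howard2004HeegnerKolyvagin, Prop. 2.2.8 and proof of Thm. 2.2.10 (arXiv p. 17, L41–53)] [cite: GreenbergLNM1716, §4 pp. 98, 104] -/
theorem finite_and_natCard_kerPsi_quotient_le_of_local {p : ℕ} [Fact p.Prime] {K : Type} [Field K] [NumberField K]
    (V : WeierstrassCurve K) (κ : ZpExtension K p) (γ : absoluteGaloisGroup K) (m : ℕ)
    {R : Type} [CommRing R] [IsDomain R] [IsDiscreteValuationRing R] [Algebra ℤ_[p] R]
    {N : ℕ → Type} [∀ k, AddCommGroup (N k)] [∀ k, TopologicalSpace (N k)] [∀ k, DiscreteTopology (N k)]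
    [∀ k, Module R (N k)]
    {Rk : ℕ → Type} [∀ k, CommRing (Rk k)] [∀ k, IsLocalRing (Rk k)] [∀ k, TopologicalSpace (Rk k)]
    [∀ k, DiscreteTopology (Rk k)] [∀ k, Algebra ℤ_[p] (Rk k)] [∀ k, Algebra R (Rk k)]
    [∀ k, Module (Rk k) (N k)] [∀ k, IsScalarTower R (Rk k) (N k)]
    {Nbar : Type} [AddCommGroup Nbar] [TopologicalSpace Nbar] [DiscreteTopology Nbar] [∀ k, Module (Rk k) Nbar]
    {Nq : ℕ → Finset (HeightOneSpectrum (𝓞 K)) → Type} [∀ k n, AddCommGroup (Nq k n)]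
    [∀ k n, TopologicalSpace (Nq k n)] [∀ k n, DiscreteTopology (Nq k n)] [∀ k n, Module (Rk k) (Nq k n)]
    [∀ k n, Module R (Nq k n)] [∀ k n, IsScalarTower R (Rk k) (Nq k n)]
    (St : DVRSetting p K R N Rk Nbar Nq) (hy : St.SatisfiesH) (hπ : St.π ∈ IsLocalRing.maximalIdeal R)
    (he : ∀ k, St.e k ≤ St.e (k + 1))
    -- the readout and its three properties
    (ι₀ : AdicTower.H1A St.T St.π St.e hy.killed hy.ker_red hπ he →+ V.subgroupH1 p κ.kerSubgroup)
    (θ : AddMonoid.End (V.subgroupH1 p κ.kerSubgroup)) (hθ : ∀ s, θ s = V.conjH1 p κ.kerSubgroup γ s)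
    (hinj : Function.Injective ι₀)
    (hψ : ∀ a, ((θ - 1) ^ m + (p : AddMonoid.End (V.subgroupH1 p κ.kerSubgroup))) (ι₀ a) = 0)
    (hsurj : ∀ s, ((θ - 1) ^ m + (p : AddMonoid.End (V.subgroupH1 p κ.kerSubgroup))) s = 0 → ∃ a, ι₀ a = s)
    -- the place-wise inputs
    (S : Finset (HeightOneSpectrum (𝓞 K))) (F' : ∀ j, SelmerStructure (St.T.ρ j)) (j₀ C : ℕ)
    (hS : ∀ j, j₀ ≤ j → ∀ c : galoisCohomology (St.T.ρ j) 1,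
      ι₀ (AddCommGroup.DirectLimit.of (fun k => galoisCohomology (St.T.ρ k) 1)
        (AdicTower.incH1LE St.T St.π St.e hy.killed hy.ker_red hπ he) j c) ∈ V.selmerInfty κ →
        ∀ v ∈ S, galoisCohomology.localization (St.T.ρ j) (Sum.inr v) 1 c ∈ F' j (Sum.inr v))
    (hoff : ∀ j, j₀ ≤ j → ∀ c : galoisCohomology (St.T.ρ j) 1,
      ι₀ (AddCommGroup.DirectLimit.of (fun k => galoisCohomology (St.T.ρ k) 1)
        (AdicTower.incH1LE St.T St.π St.e hy.killed hy.ker_red hπ he) j c) ∈ V.selmerInfty κ →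
        ∀ v ∉ S, galoisCohomology.localization (St.T.ρ j) (Sum.inr v) 1 c ∈
          AdicTower.condA St.T St.π St.e hy.killed hy.ker_red hπ he (fun k => (St.t k).cond) j (Sum.inr v))
    (hinf : ∀ j, j₀ ≤ j → ∀ c : galoisCohomology (St.T.ρ j) 1,
      ι₀ (AddCommGroup.DirectLimit.of (fun k => galoisCohomology (St.T.ρ k) 1)
        (AdicTower.incH1LE St.T St.π St.e hy.killed hy.ker_red hπ he) j c) ∈ V.selmerInfty κ →
        ∀ w : InfinitePlace K, galoisCohomology.localization (St.T.ρ j) (Sum.inl w) 1 c ∈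
          AdicTower.condA St.T St.π St.e hy.killed hy.ker_red hπ he (fun k => (St.t k).cond) j (Sum.inl w))
    (hfin : ∀ j, j₀ ≤ j → ∀ v ∈ S, Finite (↥(F' j (Sum.inr v)) ⧸
      (AdicTower.condA St.T St.π St.e hy.killed hy.ker_red hπ he (fun k => (St.t k).cond) j
        (Sum.inr v)).addSubgroupOf (F' j (Sum.inr v))))
    (hC : ∀ j, j₀ ≤ j → ∏ v ∈ S, Nat.card (↥(F' j (Sum.inr v)) ⧸
      (AdicTower.condA St.T St.π St.e hy.killed hy.ker_red hπ he (fun k => (St.t k).cond) j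
        (Sum.inr v)).addSubgroupOf (F' j (Sum.inr v))) ≤ C) :
    Finite (↥(((V.conjSelmerInfty κ γ - 1) ^ m + (p : AddMonoid.End (V.selmerInfty κ))).ker) ⧸
        (((St.T.selmerA St.π St.e hy.killed hy.ker_red hπ he (fun k => (St.t k).cond)).map ι₀).comap
            (V.selmerInfty κ).subtype).addSubgroupOf
          (((V.conjSelmerInfty κ γ - 1) ^ m + (p : AddMonoid.End (V.selmerInfty κ))).ker)) ∧
      Nat.card (↥(((V.conjSelmerInfty κ γ - 1) ^ m + (p : AddMonoid.End (V.selmerInfty κ))).ker) ⧸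
        (((St.T.selmerA St.π St.e hy.killed hy.ker_red hπ he (fun k => (St.t k).cond)).map ι₀).comap
            (V.selmerInfty κ).subtype).addSubgroupOf
          (((V.conjSelmerInfty κ γ - 1) ^ m + (p : AddMonoid.End (V.selmerInfty κ))).ker)) ≤ C := by
  obtain ⟨hF, hle⟩ := DVRSetting.finite_and_natCard_quotient_selmerA_le_prod_finite St hy hπ he
    ((V.selmerInfty κ).comap ι₀) S F' j₀ C
    (fun j hj c hc v hv => hS j hj c (AddSubgroup.mem_comap.mp hc) v hv)
    (fun j hj c hc v hv => hoff j hj c (AddSubgroup.mem_comap.mp hc) v hv)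
    (fun j hj c hc w => hinf j hj c (AddSubgroup.mem_comap.mp hc) w) hfin hC
  refine ⟨?_, ?_⟩
  · exact (V.finite_quotient_iff_of_readout κ γ m _ ι₀ θ hθ hinj hψ hsurj).mpr hF
  · rw [V.natCard_quotient_eq_of_readout κ γ m _ ι₀ θ hθ hinj hψ hsurj]
    exact hle

/-! ## §2 The curve: Howard's Eisenstein setting and readout, (B1)/(B2) discharged from `E(K)[p] = 0` -/

variable {K : Type} [Field K] [NumberField K] (W : WeierstrassCurve ℚ) [W.IsElliptic] {p : ℕ} [hp : Fact p.Prime]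
  (κ : ZpExtension K p) {γ : absoluteGaloisGroup K} {m : ℕ} (hm : 1 ≤ m)

/-- **(B5) from place-wise inputs, for the curve.** For `E = W_K` with `E(K)[p] = 0`, a topological generator `γ` of `κ`,
Howard's Eisenstein setting `St = W.eisensteinDVRSetting (κ.unitTwist (-1)) hm S …` with H.0–H.5 and the readout
`ι₀ = W.eisensteinTowerReadout …` (binders in the letter of `Stmt.readoutIndex`): if for every tower level `j ≥ j₀` the
classes `c ∈ H¹(K, T_j)` whose readout is Selmer over `K_∞` satisfy relaxed conditions `F'_{j,v}` at the places `v ∈ S'`,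
Howard's `condA` conditions at the other finite places and at the infinite places, the local quotients at `v ∈ S'` being
finite with `∏_{v ∈ S'} # ≤ C`, then `Sel_∞[ψ_m] ⧸ (ι₀(H¹_F(K, A_𝔮)) ∩ Sel_∞)` is finite of order `≤ C`.
[cite: Howard2004HeegnerKolyvagin, Prop. 2.2.8 and proof of Thm. 2.2.10 (arXiv p. 17 L41–53, p. 18 L31)]
[cite: GreenbergLNM1716, §4 pp. 98, 104, 124] -/
theorem finite_and_natCard_kerPsi_quotient_eisensteinTowerReadout_le_of_local (hγ : κ.IsTopGenerator γ)
    (hE : ∀ P : (W.baseChange K).toAffine.Point, p • P = 0 → P = 0) :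
    letI := IwasawaAlgebra.isDomain_quotient_X_pow_add_C p hm
    letI := IwasawaAlgebra.isDiscreteValuationRing_quotient_X_pow_add_C p hm
    haveI := IwasawaAlgebra.EisensteinCoeff.isLocalRing_succ p hm
    letI := IwasawaAlgebra.EisensteinCoeff.algebraOfSpecSucc p m
    haveI := W.isScalarTower_algebraOfSpecSucc (K := K) (p := p) (m := m)
    letI := W.residueModuleSucc (K := K) (p := p) hm
    ∀ (S : Finset (HeightOneSpectrum (𝓞 K)))
      (hpS : ∀ v, ((p : ℕ) : 𝓞 K) ∈ v.asIdeal → v ∈ S)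
      (hbad : ∀ v, v ∉ S → ((p : ℕ) : 𝓞 K) ∉ v.asIdeal → (W.baseChange K).HasGoodReductionAt v)
      (L : Set (HeightOneSpectrum (𝓞 K)))
      (hL : L ⊆ (W.eisensteinTower (κ.unitTwist (-1)) hm).degreeTwoPrimes p)
      (hLS : ∀ v ∈ L, v ∉ S) (jbar' : AlgebraicClosure K →+* ℂ) (cd : ConjugationDatum K)
      (Dd : ∀ k, DualityDatum p cd ((W.eisensteinTower (κ.unitTwist (-1)) hm).ρ k)
        (IwasawaAlgebra.EisensteinCoeff p m (k + 1)))
      (fs : ∀ (k : ℕ) (n : Finset (HeightOneSpectrum (𝓞 K))) (v : HeightOneSpectrum (𝓞 K)),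
        galoisCohomology ((W.eisensteinLevelQuot (κ.unitTwist (-1)) hm k n).toLocal (Sum.inr v)) 1 →+
          SingularQuotient (GaloisRep.toLocal v (W.eisensteinLevelQuot (κ.unitTwist (-1)) hm k n)) ⊗[ℤ] Gell v)
      (hy : (W.eisensteinDVRSetting (κ.unitTwist (-1)) hm S hpS hbad L hL hLS jbar' cd Dd fs).SatisfiesH)
      (hπ : (W.eisensteinDVRSetting (κ.unitTwist (-1)) hm S hpS hbad L hL hLS jbar' cd Dd fs).π ∈
        IsLocalRing.maximalIdeal
          (IwasawaAlgebra p ⧸ Ideal.span {(PowerSeries.X ^ m + PowerSeries.C (p : ℤ_[p]) : IwasawaAlgebra p)}))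
      (he : ∀ k, (W.eisensteinDVRSetting (κ.unitTwist (-1)) hm S hpS hbad L hL hLS jbar' cd Dd fs).e k ≤
        (W.eisensteinDVRSetting (κ.unitTwist (-1)) hm S hpS hbad L hL hLS jbar' cd Dd fs).e (k + 1))
      (hπX : (W.eisensteinDVRSetting (κ.unitTwist (-1)) hm S hpS hbad L hL hLS jbar' cd Dd fs).π =
        Ideal.Quotient.mk (Ideal.span {(PowerSeries.X ^ m + PowerSeries.C (p : ℤ_[p]) : IwasawaAlgebra p)})
          PowerSeries.X)
      (hek : ∀ k, (W.eisensteinDVRSetting (κ.unitTwist (-1)) hm S hpS hbad L hL hLS jbar' cd Dd fs).e (k + 1) -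
        (W.eisensteinDVRSetting (κ.unitTwist (-1)) hm S hpS hbad L hL hLS jbar' cd Dd fs).e k = m)
      -- the place-wise inputs at this `m` and datum
      (S' : Finset (HeightOneSpectrum (𝓞 K)))
      (F' : ∀ j, SelmerStructure ((W.eisensteinDVRSetting (κ.unitTwist (-1)) hm S hpS hbad L hL hLS jbar' cd Dd fs).T.ρ j))
      (j₀ C : ℕ)
      (hS' : ∀ j, j₀ ≤ j →
        ∀ c : galoisCohomology ((W.eisensteinDVRSetting (κ.unitTwist (-1)) hm S hpS hbad L hL hLS jbar' cd Dd fs).T.ρ j) 1,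
        W.eisensteinTowerReadout κ hm (W.eisensteinDVRSetting (κ.unitTwist (-1)) hm S hpS hbad L hL hLS jbar' cd Dd fs).π
            (W.eisensteinDVRSetting (κ.unitTwist (-1)) hm S hpS hbad L hL hLS jbar' cd Dd fs).e hy.killed hy.ker_red hπ he
            hπX hek
            (AddCommGroup.DirectLimit.of
              (fun k => galoisCohomology
                ((W.eisensteinDVRSetting (κ.unitTwist (-1)) hm S hpS hbad L hL hLS jbar' cd Dd fs).T.ρ k) 1)
              (AdicTower.incH1LE (W.eisensteinDVRSetting (κ.unitTwist (-1)) hm S hpS hbad L hL hLS jbar' cd Dd fs).T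
                (W.eisensteinDVRSetting (κ.unitTwist (-1)) hm S hpS hbad L hL hLS jbar' cd Dd fs).π
                (W.eisensteinDVRSetting (κ.unitTwist (-1)) hm S hpS hbad L hL hLS jbar' cd Dd fs).e hy.killed hy.ker_red
                hπ he) j c) ∈ (W.baseChange K).selmerInfty κ →
          ∀ v ∈ S', galoisCohomology.localization
            ((W.eisensteinDVRSetting (κ.unitTwist (-1)) hm S hpS hbad L hL hLS jbar' cd Dd fs).T.ρ j) (Sum.inr v) 1 c ∈
              F' j (Sum.inr v))
      (hoff : ∀ j, j₀ ≤ j →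
        ∀ c : galoisCohomology ((W.eisensteinDVRSetting (κ.unitTwist (-1)) hm S hpS hbad L hL hLS jbar' cd Dd fs).T.ρ j) 1,
        W.eisensteinTowerReadout κ hm (W.eisensteinDVRSetting (κ.unitTwist (-1)) hm S hpS hbad L hL hLS jbar' cd Dd fs).π
            (W.eisensteinDVRSetting (κ.unitTwist (-1)) hm S hpS hbad L hL hLS jbar' cd Dd fs).e hy.killed hy.ker_red hπ he
            hπX hek
            (AddCommGroup.DirectLimit.of
              (fun k => galoisCohomology
                ((W.eisensteinDVRSetting (κ.unitTwist (-1)) hm S hpS hbad L hL hLS jbar' cd Dd fs).T.ρ k) 1)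
              (AdicTower.incH1LE (W.eisensteinDVRSetting (κ.unitTwist (-1)) hm S hpS hbad L hL hLS jbar' cd Dd fs).T
                (W.eisensteinDVRSetting (κ.unitTwist (-1)) hm S hpS hbad L hL hLS jbar' cd Dd fs).π
                (W.eisensteinDVRSetting (κ.unitTwist (-1)) hm S hpS hbad L hL hLS jbar' cd Dd fs).e hy.killed hy.ker_red
                hπ he) j c) ∈ (W.baseChange K).selmerInfty κ →
          ∀ v ∉ S', galoisCohomology.localization
            ((W.eisensteinDVRSetting (κ.unitTwist (-1)) hm S hpS hbad L hL hLS jbar' cd Dd fs).T.ρ j) (Sum.inr v) 1 c ∈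
              AdicTower.condA (W.eisensteinDVRSetting (κ.unitTwist (-1)) hm S hpS hbad L hL hLS jbar' cd Dd fs).T
                (W.eisensteinDVRSetting (κ.unitTwist (-1)) hm S hpS hbad L hL hLS jbar' cd Dd fs).π
                (W.eisensteinDVRSetting (κ.unitTwist (-1)) hm S hpS hbad L hL hLS jbar' cd Dd fs).e hy.killed hy.ker_red
                hπ he (fun k => ((W.eisensteinDVRSetting (κ.unitTwist (-1)) hm S hpS hbad L hL hLS jbar' cd Dd fs).t k).cond)
                j (Sum.inr v))
      (hinf : ∀ j, j₀ ≤ j →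
        ∀ c : galoisCohomology ((W.eisensteinDVRSetting (κ.unitTwist (-1)) hm S hpS hbad L hL hLS jbar' cd Dd fs).T.ρ j) 1,
        W.eisensteinTowerReadout κ hm (W.eisensteinDVRSetting (κ.unitTwist (-1)) hm S hpS hbad L hL hLS jbar' cd Dd fs).π
            (W.eisensteinDVRSetting (κ.unitTwist (-1)) hm S hpS hbad L hL hLS jbar' cd Dd fs).e hy.killed hy.ker_red hπ he
            hπX hek
            (AddCommGroup.DirectLimit.of
              (fun k => galoisCohomology
                ((W.eisensteinDVRSetting (κ.unitTwist (-1)) hm S hpS hbad L hL hLS jbar' cd Dd fs).T.ρ k) 1)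
              (AdicTower.incH1LE (W.eisensteinDVRSetting (κ.unitTwist (-1)) hm S hpS hbad L hL hLS jbar' cd Dd fs).T
                (W.eisensteinDVRSetting (κ.unitTwist (-1)) hm S hpS hbad L hL hLS jbar' cd Dd fs).π
                (W.eisensteinDVRSetting (κ.unitTwist (-1)) hm S hpS hbad L hL hLS jbar' cd Dd fs).e hy.killed hy.ker_red
                hπ he) j c) ∈ (W.baseChange K).selmerInfty κ →
          ∀ w : InfinitePlace K, galoisCohomology.localization
            ((W.eisensteinDVRSetting (κ.unitTwist (-1)) hm S hpS hbad L hL hLS jbar' cd Dd fs).T.ρ j) (Sum.inl w) 1 c ∈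
              AdicTower.condA (W.eisensteinDVRSetting (κ.unitTwist (-1)) hm S hpS hbad L hL hLS jbar' cd Dd fs).T
                (W.eisensteinDVRSetting (κ.unitTwist (-1)) hm S hpS hbad L hL hLS jbar' cd Dd fs).π
                (W.eisensteinDVRSetting (κ.unitTwist (-1)) hm S hpS hbad L hL hLS jbar' cd Dd fs).e hy.killed hy.ker_red
                hπ he (fun k => ((W.eisensteinDVRSetting (κ.unitTwist (-1)) hm S hpS hbad L hL hLS jbar' cd Dd fs).t k).cond)
                j (Sum.inl w))
      (hfin : ∀ j, j₀ ≤ j → ∀ v ∈ S', Finite (↥(F' j (Sum.inr v)) ⧸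
        (AdicTower.condA (W.eisensteinDVRSetting (κ.unitTwist (-1)) hm S hpS hbad L hL hLS jbar' cd Dd fs).T
          (W.eisensteinDVRSetting (κ.unitTwist (-1)) hm S hpS hbad L hL hLS jbar' cd Dd fs).π
          (W.eisensteinDVRSetting (κ.unitTwist (-1)) hm S hpS hbad L hL hLS jbar' cd Dd fs).e hy.killed hy.ker_red hπ he
          (fun k => ((W.eisensteinDVRSetting (κ.unitTwist (-1)) hm S hpS hbad L hL hLS jbar' cd Dd fs).t k).cond) j
          (Sum.inr v)).addSubgroupOf (F' j (Sum.inr v))))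
      (hC : ∀ j, j₀ ≤ j → ∏ v ∈ S', Nat.card (↥(F' j (Sum.inr v)) ⧸
        (AdicTower.condA (W.eisensteinDVRSetting (κ.unitTwist (-1)) hm S hpS hbad L hL hLS jbar' cd Dd fs).T
          (W.eisensteinDVRSetting (κ.unitTwist (-1)) hm S hpS hbad L hL hLS jbar' cd Dd fs).π
          (W.eisensteinDVRSetting (κ.unitTwist (-1)) hm S hpS hbad L hL hLS jbar' cd Dd fs).e hy.killed hy.ker_red hπ he
          (fun k => ((W.eisensteinDVRSetting (κ.unitTwist (-1)) hm S hpS hbad L hL hLS jbar' cd Dd fs).t k).cond) j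
          (Sum.inr v)).addSubgroupOf (F' j (Sum.inr v))) ≤ C),
      Finite (↥((((W.baseChange K).conjSelmerInfty κ γ - 1) ^ m +
          (p : AddMonoid.End ((W.baseChange K).selmerInfty κ))).ker) ⧸
        ((((W.eisensteinDVRSetting (κ.unitTwist (-1)) hm S hpS hbad L hL hLS jbar' cd Dd fs).T.selmerA
          (W.eisensteinDVRSetting (κ.unitTwist (-1)) hm S hpS hbad L hL hLS jbar' cd Dd fs).π
          (W.eisensteinDVRSetting (κ.unitTwist (-1)) hm S hpS hbad L hL hLS jbar' cd Dd fs).e hy.killed hy.ker_red hπ he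
          (fun k ↦ ((W.eisensteinDVRSetting (κ.unitTwist (-1)) hm S hpS hbad L hL hLS jbar' cd Dd fs).t k).cond)).map
          (W.eisensteinTowerReadout κ hm (W.eisensteinDVRSetting (κ.unitTwist (-1)) hm S hpS hbad L hL hLS jbar' cd Dd fs).π
            (W.eisensteinDVRSetting (κ.unitTwist (-1)) hm S hpS hbad L hL hLS jbar' cd Dd fs).e hy.killed hy.ker_red hπ he
            hπX hek)).comap ((W.baseChange K).selmerInfty κ).subtype).addSubgroupOf
          ((((W.baseChange K).conjSelmerInfty κ γ - 1) ^ m +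
            (p : AddMonoid.End ((W.baseChange K).selmerInfty κ))).ker)) ∧
      Nat.card (↥((((W.baseChange K).conjSelmerInfty κ γ - 1) ^ m +
          (p : AddMonoid.End ((W.baseChange K).selmerInfty κ))).ker) ⧸
        ((((W.eisensteinDVRSetting (κ.unitTwist (-1)) hm S hpS hbad L hL hLS jbar' cd Dd fs).T.selmerA
          (W.eisensteinDVRSetting (κ.unitTwist (-1)) hm S hpS hbad L hL hLS jbar' cd Dd fs).π
          (W.eisensteinDVRSetting (κ.unitTwist (-1)) hm S hpS hbad L hL hLS jbar' cd Dd fs).e hy.killed hy.ker_red hπ he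
          (fun k ↦ ((W.eisensteinDVRSetting (κ.unitTwist (-1)) hm S hpS hbad L hL hLS jbar' cd Dd fs).t k).cond)).map
          (W.eisensteinTowerReadout κ hm (W.eisensteinDVRSetting (κ.unitTwist (-1)) hm S hpS hbad L hL hLS jbar' cd Dd fs).π
            (W.eisensteinDVRSetting (κ.unitTwist (-1)) hm S hpS hbad L hL hLS jbar' cd Dd fs).e hy.killed hy.ker_red hπ he
            hπX hek)).comap ((W.baseChange K).selmerInfty κ).subtype).addSubgroupOf
          ((((W.baseChange K).conjSelmerInfty κ γ - 1) ^ m +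
            (p : AddMonoid.End ((W.baseChange K).selmerInfty κ))).ker)) ≤ C := by
  letI := IwasawaAlgebra.isDomain_quotient_X_pow_add_C p hm
  letI := IwasawaAlgebra.isDiscreteValuationRing_quotient_X_pow_add_C p hm
  haveI := IwasawaAlgebra.EisensteinCoeff.isLocalRing_succ p hm
  letI := IwasawaAlgebra.EisensteinCoeff.algebraOfSpecSucc p m
  haveI := W.isScalarTower_algebraOfSpecSucc (K := K) (p := p) (m := m)
  letI := W.residueModuleSucc (K := K) (p := p) hm
  intro S hpS hbad L hL hLS jbar' cd Dd fs hy hπ he hπX hek S' F' j₀ C hS' hoff hinf hfin hC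
  exact finite_and_natCard_kerPsi_quotient_le_of_local (W.baseChange K) κ γ m
    (W.eisensteinDVRSetting (κ.unitTwist (-1)) hm S hpS hbad L hL hLS jbar' cd Dd fs) hy hπ he
    (W.eisensteinTowerReadout κ hm (W.eisensteinDVRSetting (κ.unitTwist (-1)) hm S hpS hbad L hL hLS jbar' cd Dd fs).π
      (W.eisensteinDVRSetting (κ.unitTwist (-1)) hm S hpS hbad L hL hLS jbar' cd Dd fs).e hy.killed hy.ker_red hπ he hπX hek)
    ((W.baseChange K).conjH1 p κ.kerSubgroup γ) (fun _ ↦ rfl)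
    (W.eisensteinTowerReadout_injective κ hm _ _ hy.killed hy.ker_red hπ he hπX hek hγ hE)
    (W.psi_apply_eisensteinTowerReadout_eq_zero κ hm _ _ hy.killed hy.ker_red hπ he hπX hek hγ _ (fun _ ↦ rfl))
    (fun s hs ↦ W.exists_eisensteinTowerReadout_eq κ hm _ _ hy.killed hy.ker_red hπ he hπX hek hγ hE _ (fun _ ↦ rfl) s hs)
    S' F' j₀ C hS' hoff hinf hfin hC

end WeierstrassCurve

end
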